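import Literature.MathematicalPhysics.QuantumFieldTheory.Balaban1983to89.B9Thm313WholeHolderZ

/-!
# `Balaban1983to89.B9Thm313WholeProbe43LCut` — [B9] Theorem 3.13 (p. 426): the LEFT (3.43) Hölder-probe member Φ^Y_β∇_U𝔊 of the
# Theorem-3.13 reduction RE-ISSUED over the five KEPT fields `gD2 gQs2 rgd2 c1_2 q2` of `Letters313Z` as separate hypotheses — reader layer
# under the N06 LETTERS-SPECIES re-cut (WANTED №g26-7), sequel of `B9Thm313WholeSupReadersCut`

T. Bałaban, *Propagators for lattice gauge theories in a background field*, Commun. Math. Phys. **99** (1985) 389–434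
[`Balaban1985BackgroundPropagators`, "B9"]; [4] = T. Bałaban, *Propagators and renormalization transformations for lattice gauge
theories. II*, Commun. Math. Phys. **96** (1984) 223–250 [`Balaban1984PropagatorsII`].

statement-level skeleton of published theorems with citation tags; proofs where landed; nothing here is a claim about the Yang–Mills
mass gap

THE PRINTED LOCUS (held text `paper:balaban1985-cmp99-background-propagators`).  p. 426, (3.153): *"𝔊 = G₁ − G₁DRD\*G₁ − G₁Q\*(QG₁Q\*)⁻¹QG₁
= G₁𝔓\* = 𝔓G₁"*; *"The formulas (3.147), (3.153) permit us to reduce properties of the operators 𝔓, 𝔊 to the corresponding properties of the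
operators G′, (Q′G′²Q′\*)⁻¹, G₁, (QG₁Q\*)⁻¹"*; Theorem 3.13 p. 426 (Theorem 3.3 holds for 𝔊: the sup entries (3.42) p. 397 and the Hölder entries
(3.43) p. 398).

THE POINT (cell `pub/ym-inputs` seat p04 g2, LOCATE «READER LAYER» 2026-08-28T11:03Z on `pub/pub-ymgap/INBOX.md`; hazard «N06-LETTERS-SPECIES»
of ★★OWNER ym3-torus-plan RULING g26-№21 (5), WANTED №g26-7; the cut SCHEMA and the composites L4–L7 are dag-n06-l g19's).  The located field
`Letters313Z.rgd1` (and `gD1`, read only next to it) is read by `GG_entry2_of_lettersZ` and `GG_probe43R_of_lettersZ`, already re-cut without it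
(`B9Thm313WholeEntry2HolderCut`, `B9Thm313WholeProbe43RHolderCut`).  The OTHER sup-side readers of `Letters313Z` under the Theorem-3.13 leaf read
ONLY the kept fields `gD2 gQs2 rgd2 c1_2 q2` but take the WHOLE structure as a binder, so no cut schema can be passed to them.  THIS FILE re-issues
`B9Thm313WholeHolderZ.GG_probe43L_of_lettersZ` ((3.43)₁, Φ^Y_β∇_U𝔊 — the partner of the already re-cut `GG_probe43R_holderCut_of_letters`) with the
structure binder replaced by EXACTLY those five fields as hypotheses `hLgD2 hLgQs2 hLrgd2 hLc1_2 hLq2` (the fields' types VERBATIM; the weight binders `(wZ) (hwZ)`, implicit in the parent where the record fixed them, become EXPLICIT right before the field hypotheses — `hwZ` occurs in the field types only inside proofs, so it is not unifiable); every other binder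
(`hrgdH`, `hpQ`, `hpD`, `h43`, `hpY`, …), the conclusion and the constant `constH313 …` are byte-identical and the proof is the parent's with
`hL.x ↦ hx`:
* ★ `GG_probe43L_cut_of_letters` — statement of `GG_probe43L_of_lettersZ` over the five fields.
The parent follows by projection; a cut schema (dag-n06-l) feeds it by its projections.

HONEST SCOPE.  Kernel bookkeeping over landed modules (`hasMaj_frakG_classes`, `hasMaj_right_of_step(_weight)`, `hasMaj_left_right(R)`,
`GG_comp_eq ∕ D_GG_eq ∕ E_GG_eq`); the five kept letters stay HYPOTHESES of printed species, nothing of [B9]'s estimates is asserted; COUNT-NEUTRAL;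
N06 NOT discharged; no summit or sub-problem statement is proved (YM₃ on T³ = ladder rung R3, a RECORD rung — not T⁴, not a mass gap, not Clay).
One finite lattice at a time.  Seat `ym-inputs-p04` g2 (prover-ym-inputs-p04-g2-0), 2026-08-28; NEW file, nothing landed is modified.
-/

namespace Literature.MathematicalPhysics.QuantumFieldTheory.Balaban1983to89.B9Thm313WholeProbe43LCut

open Literature.MathematicalPhysics.QuantumFieldTheory.Balaban1983to89
open Finset B6RandomWalk B6RandomWalkHom B9Thm34Ext B9Thm37GlueCor36 B11SectG B9SectDSup
open B9Thm37AllNorms B9Thm37AllNormsInstances B9Thm312Whole B9Thm312WholeLeaf B9Thm312WholeLeft B9Thm313Whole B9Thm313WholeLeft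
open B9RWSums343Holder B9Ineq347 B9Thm312WholeClasses B9Thm312WholeHolder B9Thm312WholeHHolder B9Thm313WholeHolder
open B9Thm313WholeZ B9Thm313WholeLeftZ B9Thm313WholeHolderZ

noncomputable section

section OneMember

variable {g : B9.Geometry} {B : B9.Backgrounds} {X Y Z W PX PY : Type}
variable [Fintype X] [Fintype Y] [Fintype Z] [Fintype W] [Fintype PX] [Fintype PY] [Fintype g.Site]
variable {R₀ : ℝ} {H₀ : Prop}

omit [Fintype Y] [Fintype PX] in
/-- ★ **THEOREM 3.13, THE LEFT (3.43) MEMBER OF 𝔊 — Φ^Y_β∘∇_U∘𝔊 — OVER THE FIVE KEPT LETTERS** (statement of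
`B9Thm313WholeHolderZ.GG_probe43L_of_lettersZ` with the binder `hL : Letters313Z …` replaced by its fields `gD2 gQs2 rgd2 c1_2 q2` as hypotheses;
`hrgdH`, `hpQ`, `hpD`, `h43`, `hpY` and everything else unchanged; proof verbatim): from Theorem 3.3's (3.42)₁ (`he0`) and the probe of (3.43)₁
(`h43`) for G₀, the step on 𝔠⁽²⁾ (`hK`, θc < 1) and its Hölder probe (`hpY`), the resolvent identity, the five kept letters, `hrgdH` (RD\*G₁ into the
scalar Hölder class `bW`), the probe letters `hpQ` (Φ∇G₀Q\* out of `Z_{wZ}`) and `hpD` (Φ∇G₀D out of `bW`), and (3.153): Φ^Y_β∘∇_U∘𝔊 has majorant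
`constH313 …`·(Lʲη)^{1−β}·e^{−ρ′d} from 𝔠⁽⁰⁾ into the probe class (ρ′ + 3σ ≦ ρ ≦ min(δ₀, δ₃), ρ + σ ≦ δ_K).
[cite: Balaban1985BackgroundPropagators, Thm 3.13 p.426 + (3.152)–(3.153) p.426 + (3.138) p.423 + (3.43) p.398 + (3.49) p.399; Balaban1984PropagatorsII, (2.54) p.233 + Lemma 2.1 (2.61) p.234] -/
theorem GG_probe43L_cut_of_letters (hG : GeoOK g) {𝔬 : Ops g B X Y Z W} (𝔭 : HolderProbes g B X Y PX PY) {U : B.Cfg}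
    {bW : BlockNorm (toB6 g R₀ H₀) (W → ℝ)} {θ θH B₀ B₃ Bh Bq Bd β δ₀ δ₃ δK ρ ρ' σ c : ℝ} (hrow : RowSum (toB6 g R₀ H₀) σ c) (hc : 0 ≤ c)
    (hθ : 0 ≤ θ) (hθH : 0 ≤ θH) (hB₀ : 0 ≤ B₀) (hB₃ : 0 ≤ B₃) (hBh : 0 ≤ Bh) (hBq : 0 ≤ Bq) (hBd : 0 ≤ Bd) (hσ : 0 ≤ σ) (hρ' : 0 ≤ ρ')
    (hρ'ρ : ρ' + 3 * σ ≤ ρ) (hρS : ρ ≤ δ₀) (hρ₃ : ρ ≤ δ₃) (hρδ : ρ + σ ≤ δK) (hq : θ * c < 1)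
    (hK : HasMaj (cNorm R₀ H₀ 𝔬.blk hG.lenle 2) (cNorm R₀ H₀ 𝔬.blk hG.lenle 2) (𝔬.G0 U ∘ₗ (𝔬.Tpi U + 𝔬.T2 U))
      (fun a b => θ * Real.exp (-(δK * g.dist a b))))
    (he0 : HasMajorant (g := toB6 g R₀ H₀) 𝔬.blk (𝔬.G0 U) (fun a b => B₀ * g.len a ^ 2 * Real.exp (-(δ₀ * g.dist a b))))
    (h43 : HasMajorantHom (g := toB6 g R₀ H₀) 𝔬.blk 𝔭.blkPY (𝔭.ΦY U β ∘ₗ (𝔬.D U ∘ₗ 𝔬.G0 U))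
      (fun (a b : g.Site) => Bh * g.len a ^ (1 - β) * Real.exp (-(δ₀ * g.dist a b))))
    (hpY : HasMaj (cNormR R₀ H₀ 𝔬.blk hG.lenle (-2)) (cNormR R₀ H₀ 𝔭.blkPY hG.lenle (β - 1))
      ((𝔭.ΦY U β ∘ₗ 𝔬.D U ∘ₗ 𝔬.G0 U) ∘ₗ (𝔬.Tpi U + 𝔬.T2 U)) (fun a b => θH * Real.exp (-(δK * g.dist a b))))
    (wZ : g.Site → ℝ) (hwZ : ∀ y, 0 < wZ y)
    (hpQ : HasMaj (weightNorm (BlockNorm.ofBlocks (toB6 g R₀ H₀) 𝔬.blkZ) wZ fun y => (hwZ y).le) (cNormR R₀ H₀ 𝔭.blkPY hG.lenle (β - 1))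
      ((𝔭.ΦY U β ∘ₗ 𝔬.D U ∘ₗ 𝔬.G0 U) ∘ₗ 𝔬.Qstar U) (fun a b => Bq * Real.exp (-(δ₃ * g.dist a b))))
    (hpD : HasMaj bW (cNormR R₀ H₀ 𝔭.blkPY hG.lenle (β - 1)) ((𝔭.ΦY U β ∘ₗ 𝔬.D U ∘ₗ 𝔬.G0 U) ∘ₗ 𝔬.Dv U)
      (fun a b => Bd * Real.exp (-(δ₃ * g.dist a b))))
    (hLgD2 : HasMaj (cNorm R₀ H₀ 𝔬.blkW hG.lenle 1) (cNorm R₀ H₀ 𝔬.blk hG.lenle 2) (𝔬.G0 U ∘ₗ 𝔬.Dv U)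
      (fun a b => B₃ * Real.exp (-(δ₃ * g.dist a b))))
    (hLgQs2 : HasMaj (weightNorm (BlockNorm.ofBlocks (toB6 g R₀ H₀) 𝔬.blkZ) wZ fun y => (hwZ y).le) (cNorm R₀ H₀ 𝔬.blk hG.lenle 2)
      (𝔬.G0 U ∘ₗ 𝔬.Qstar U) (fun a b => B₃ * Real.exp (-(δ₃ * g.dist a b))))
    (hLrgd2 : HasMaj (cNorm R₀ H₀ 𝔬.blk hG.lenle 0) (cNorm R₀ H₀ 𝔬.blkW hG.lenle 1) (𝔬.R U ∘ₗ 𝔬.Dvstar U ∘ₗ 𝔬.G1 U ∘ₗ LinearMap.id)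
      (fun a b => B₃ * Real.exp (-(δ₃ * g.dist a b))))
    (hLc1_2 : HasMaj (cNorm R₀ H₀ 𝔬.blkZ hG.lenle 2) (weightNorm (BlockNorm.ofBlocks (toB6 g R₀ H₀) 𝔬.blkZ) wZ fun y => (hwZ y).le) (𝔬.C1 U)
      (fun a b => B₃ * Real.exp (-(δ₃ * g.dist a b))))
    (hLq2 : HasMaj (cNorm R₀ H₀ 𝔬.blk hG.lenle 2) (cNorm R₀ H₀ 𝔬.blkZ hG.lenle 2) (𝔬.Q U) (fun a b => B₃ * Real.exp (-(δ₃ * g.dist a b))))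
    (hrgdH : HasMaj (cNorm R₀ H₀ 𝔬.blk hG.lenle 0) bW
      (𝔬.R U ∘ₗ 𝔬.Dvstar U ∘ₗ 𝔬.G1 U ∘ₗ LinearMap.id) (fun a b => B₃ * Real.exp (-(δ₃ * g.dist a b))))
    (hI : Identities 𝔬 U) :
    HasMajorantHom (g := toB6 g R₀ H₀) 𝔬.blk 𝔭.blkPY (𝔭.ΦY U β ∘ₗ (𝔬.D U ∘ₗ 𝔬.GG U))
      (fun (a b : g.Site) => constH313 (Bh + θH * (B₀ * (1 - θ * c)⁻¹) * c) θH (B₀ * (1 - θ * c)⁻¹) (B₃ * (1 - θ * c)⁻¹) B₃ Bd Bq bW.κ c *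
        g.len a ^ (1 - β) * Real.exp (-(ρ' * g.dist a b))) := by
  have hinv1 : 0 ≤ (1 - θ * c)⁻¹ := inv_nonneg.mpr (by linarith)
  have hA₁ : 0 ≤ B₀ * (1 - θ * c)⁻¹ := mul_nonneg hB₀ hinv1
  have hA₃ : 0 ≤ B₃ * (1 - θ * c)⁻¹ := mul_nonneg hB₃ hinv1
  have hCL : 0 ≤ Bh + θH * (B₀ * (1 - θ * c)⁻¹) * c := add_nonneg hBh (mul_nonneg (mul_nonneg hθH hA₁) hc)
  have hfix1 := fix_of_inverses hI.invG0' hI.invG1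
  have hρ0 : 0 ≤ ρ := by linarith
  have htri : Triangle254 (toB6 g R₀ H₀) := fun a b c => hG.tri a b c
  set E : (X → ℝ) →ₗ[ℝ] (PY → ℝ) := 𝔭.ΦY U β ∘ₗ 𝔬.D U with hE
  set bout := cNormR R₀ H₀ 𝔭.blkPY hG.lenle (β - 1) with hbout
  -- (a) the right entries of G₁ in the real classes: G₁ : 𝔠^{(0)} → 𝔠^{(−2)}, G₁D : W^{(−1)} → 𝔠^{(−2)}, G₁Q* : Z_{wZ} → 𝔠^{(−2)}
  have hG1 : HasMaj (cNormR R₀ H₀ 𝔬.blk hG.lenle 0) (cNormR R₀ H₀ 𝔬.blk hG.lenle (-2)) (𝔬.G1 U ∘ₗ LinearMap.id)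
      (fun a b => B₀ * (1 - θ * c)⁻¹ * Real.exp (-(ρ * g.dist a b))) := by
    rw [LinearMap.comp_id]
    have h := hasMaj_toR hG (hasMaj_entry0_cNorm hG hrow hθ hB₀ hρ0 hρS hρδ hK he0 hfix1 hq)
    simp only [Nat.cast_zero, neg_zero, Nat.cast_ofNat] at h
    exact h
  have hGD : HasMaj (cNormR R₀ H₀ 𝔬.blkW hG.lenle (-1)) (cNormR R₀ H₀ 𝔬.blk hG.lenle (-2)) (𝔬.G1 U ∘ₗ 𝔬.Dv U)
      (fun a b => B₃ * (1 - θ * c)⁻¹ * Real.exp (-(ρ * g.dist a b))) := by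
    have h := hasMaj_toR hG (hasMaj_right_of_step hG hrow hθ hB₃ hρ0 hρ₃ hρδ hK hLgD2 hfix1 hq)
    simp only [Nat.cast_one, Nat.cast_ofNat] at h
    exact h
  have hGQ : HasMaj (weightNorm (BlockNorm.ofBlocks (toB6 g R₀ H₀) 𝔬.blkZ) wZ fun y => (hwZ y).le) (cNormR R₀ H₀ 𝔬.blk hG.lenle (-2))
      (𝔬.G1 U ∘ₗ 𝔬.Qstar U) (fun a b => B₃ * (1 - θ * c)⁻¹ * Real.exp (-(ρ * g.dist a b))) := by
    have h := hasMaj_toR_tgt hG (hasMaj_right_of_step_weight hG hwZ hrow hθ hB₃ hρ0 hρ₃ hρδ hK hLgQs2 hfix1 hq)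
    simp only [Nat.cast_ofNat] at h
    exact h
  -- (b) the head E G₀ : 𝔠^{(0)} → 𝔠_P^{(β−1)} from (3.43)₁ for G₀, and E G₁ : 𝔠^{(0)} → 𝔠_P^{(β−1)}
  have hE0 : HasMaj (cNormR R₀ H₀ 𝔬.blk hG.lenle 0) bout (E ∘ₗ 𝔬.G0 U ∘ₗ LinearMap.id) (fun a b => Bh * Real.exp (-(δ₀ * g.dist a b))) := by
    rw [LinearMap.comp_id]
    have h43' : HasMajorantHom (g := toB6 g R₀ H₀) 𝔬.blk 𝔭.blkPY (E ∘ₗ 𝔬.G0 U)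
        (fun (a b : g.Site) => Bh * g.len a ^ (1 - β) * Real.exp (-(δ₀ * g.dist a b))) := h43
    have h := hasMaj_cNormR_of_hasMajorantHom hG (C := fun a b => Bh * Real.exp (-(δ₀ * g.dist a b)))
      (fun a b => mul_nonneg hBh (Real.exp_nonneg _)) (1 - β) 0
      (hasMajorantHom_mono (g := toB6 g R₀ H₀) 𝔬.blk 𝔭.blkPY h43' fun a b => le_of_eq (by simp only [Real.rpow_zero, mul_one]; ring))
    have e : -(1 - β) = β - 1 := by ring
    rw [e] at h
    exact h
  have hKE : HasMaj (cNormR R₀ H₀ 𝔬.blk hG.lenle (-2)) bout (E ∘ₗ 𝔬.G0 U ∘ₗ (𝔬.Tpi U + 𝔬.T2 U))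
      (fun a b => θH * Real.exp (-(δK * g.dist a b))) := hpY
  have hD1 : HasMaj (cNormR R₀ H₀ 𝔬.blk hG.lenle 0) bout (E ∘ₗ 𝔬.G1 U ∘ₗ LinearMap.id)
      (fun y y' => (Bh + θH * (B₀ * (1 - θ * c)⁻¹) * c) * Real.exp (-(ρ * g.dist y y'))) :=
    hasMaj_left_rightR hG hrow hθH hBh hA₁ hρ0 hρS le_rfl hρδ hKE hE0 hG1 hfix1
  -- (c) TERM B = (E G₁D)(RD*G₁) = (E G₀D)(RD*G₁) + ((E G₀T₁)(G₁D))(RD*G₁): the first summand through `bW`, the second through W^{(−1)}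
  have hρ'₃ : ρ' ≤ δ₃ := by linarith
  have hρ'σ₃ : ρ' + σ ≤ δ₃ := by linarith
  have hrgdH' : HasMaj (cNormR R₀ H₀ 𝔬.blk hG.lenle 0) bW (𝔬.R U ∘ₗ 𝔬.Dvstar U ∘ₗ 𝔬.G1 U ∘ₗ LinearMap.id)
      (fun a b => B₃ * Real.exp (-(δ₃ * g.dist a b))) := by
    have h := hasMaj_toR_src hG hrgdH
    simp only [Nat.cast_zero, neg_zero] at h
    exact h
  have hB1 : HasMaj (cNormR R₀ H₀ 𝔬.blk hG.lenle 0) bout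
      ((E ∘ₗ 𝔬.G0 U ∘ₗ 𝔬.Dv U) ∘ₗ (𝔬.R U ∘ₗ 𝔬.Dvstar U ∘ₗ 𝔬.G1 U ∘ₗ LinearMap.id))
      (fun y y' => bW.κ * Bd * B₃ * c * Real.exp (-(ρ' * g.dist y y'))) :=
    hasMaj_comp_exp htri hG.dnn hrow hBd hB₃ hρ' hρ'₃ hρ'σ₃ hpD hrgdH'
  have hLrgd2' : HasMaj (cNormR R₀ H₀ 𝔬.blk hG.lenle 0) (cNormR R₀ H₀ 𝔬.blkW hG.lenle (-1))
      (𝔬.R U ∘ₗ 𝔬.Dvstar U ∘ₗ 𝔬.G1 U ∘ₗ LinearMap.id) (fun a b => B₃ * Real.exp (-(δ₃ * g.dist a b))) := by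
    have h := hasMaj_toR hG hLrgd2
    simp only [Nat.cast_zero, neg_zero, Nat.cast_one] at h
    exact h
  have hGDT : HasMaj (cNormR R₀ H₀ 𝔬.blkW hG.lenle (-1)) bout
      ((E ∘ₗ 𝔬.G0 U ∘ₗ (𝔬.Tpi U + 𝔬.T2 U)) ∘ₗ (𝔬.G1 U ∘ₗ 𝔬.Dv U))
      (fun y y' => (cNormR R₀ H₀ 𝔬.blk hG.lenle (-2) (X := X)).κ * θH * (B₃ * (1 - θ * c)⁻¹) * c *
        Real.exp (-((ρ' + σ) * g.dist y y'))) :=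
    hasMaj_comp_exp htri hG.dnn hrow hθH hA₃ (by linarith) (by linarith) (by linarith) hKE hGD
  simp only [cNormR_κ, one_mul] at hGDT
  have hθA₃ : 0 ≤ θH * (B₃ * (1 - θ * c)⁻¹) * c := mul_nonneg (mul_nonneg hθH hA₃) hc
  have hB2 : HasMaj (cNormR R₀ H₀ 𝔬.blk hG.lenle 0) bout
      (((E ∘ₗ 𝔬.G0 U ∘ₗ (𝔬.Tpi U + 𝔬.T2 U)) ∘ₗ (𝔬.G1 U ∘ₗ 𝔬.Dv U)) ∘ₗ (𝔬.R U ∘ₗ 𝔬.Dvstar U ∘ₗ 𝔬.G1 U ∘ₗ LinearMap.id))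
      (fun y y' => (cNormR R₀ H₀ 𝔬.blkW hG.lenle (-1) (X := W)).κ * (θH * (B₃ * (1 - θ * c)⁻¹) * c) * B₃ * c *
        Real.exp (-(ρ' * g.dist y y'))) :=
    hasMaj_comp_exp htri hG.dnn hrow hθA₃ hB₃ hρ' hρ'₃ le_rfl hGDT hLrgd2'
  simp only [cNormR_κ, one_mul] at hB2
  have eB : (E ∘ₗ 𝔬.G1 U ∘ₗ 𝔬.Dv U) ∘ₗ (𝔬.R U ∘ₗ 𝔬.Dvstar U ∘ₗ 𝔬.G1 U ∘ₗ LinearMap.id) =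
      (E ∘ₗ 𝔬.G0 U ∘ₗ 𝔬.Dv U) ∘ₗ (𝔬.R U ∘ₗ 𝔬.Dvstar U ∘ₗ 𝔬.G1 U ∘ₗ LinearMap.id) +
        (((E ∘ₗ 𝔬.G0 U ∘ₗ (𝔬.Tpi U + 𝔬.T2 U)) ∘ₗ (𝔬.G1 U ∘ₗ 𝔬.Dv U)) ∘ₗ
          (𝔬.R U ∘ₗ 𝔬.Dvstar U ∘ₗ 𝔬.G1 U ∘ₗ LinearMap.id)) := by
    rw [comp_fix_left_right E (𝔬.Dv U) hfix1, LinearMap.add_comp]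
  have hB := hB1.add hB2
  rw [← eB] at hB
  -- (d) TERM C = (E G₁Q*)((QG₁Q*)⁻¹QG₁) through the classes Z², Z_{wZ} and the probe head `hpQ`
  have hQG : HasMaj (cNormR R₀ H₀ 𝔬.blk hG.lenle 0) (cNormR R₀ H₀ 𝔬.blkZ hG.lenle (-2)) (𝔬.Q U ∘ₗ (𝔬.G1 U ∘ₗ LinearMap.id))
      (fun a b => (cNormR R₀ H₀ 𝔬.blk hG.lenle (-2) (X := X)).κ * B₃ * (B₀ * (1 - θ * c)⁻¹) * c *
        Real.exp (-((ρ' + 2 * σ) * g.dist a b))) := by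
    have hLq2' : HasMaj (cNormR R₀ H₀ 𝔬.blk hG.lenle (-2)) (cNormR R₀ H₀ 𝔬.blkZ hG.lenle (-2)) (𝔬.Q U)
        (fun a b => B₃ * Real.exp (-(δ₃ * g.dist a b))) := by
      have h := hasMaj_toR hG hLq2
      simp only [Nat.cast_ofNat] at h
      exact h
    exact hasMaj_comp_exp htri hG.dnn hrow hB₃ hA₁ (by linarith) (by linarith) (by linarith) hLq2' hG1
  simp only [cNormR_κ, one_mul] at hQG
  have hK₁ : 0 ≤ B₃ * (B₀ * (1 - θ * c)⁻¹) * c := mul_nonneg (mul_nonneg hB₃ hA₁) hc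
  have hc12' : HasMaj (cNormR R₀ H₀ 𝔬.blkZ hG.lenle (-2)) (weightNorm (BlockNorm.ofBlocks (toB6 g R₀ H₀) 𝔬.blkZ) wZ fun y => (hwZ y).le) (𝔬.C1 U)
      (fun a b => B₃ * Real.exp (-(δ₃ * g.dist a b))) := by
    have h := hasMaj_toR_src hG hLc1_2
    simp only [Nat.cast_ofNat] at h
    exact h
  have hCQG : HasMaj (cNormR R₀ H₀ 𝔬.blk hG.lenle 0) (weightNorm (BlockNorm.ofBlocks (toB6 g R₀ H₀) 𝔬.blkZ) wZ fun y => (hwZ y).le)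
      (𝔬.C1 U ∘ₗ (𝔬.Q U ∘ₗ (𝔬.G1 U ∘ₗ LinearMap.id)))
      (fun a b => (cNormR R₀ H₀ 𝔬.blkZ hG.lenle (-2) (X := Z)).κ * B₃ * (B₃ * (B₀ * (1 - θ * c)⁻¹) * c) * c *
        Real.exp (-((ρ' + σ) * g.dist a b))) :=
    hasMaj_comp_exp htri hG.dnn hrow hB₃ hK₁ (by linarith) (by linarith) (by linarith) hc12' hQG
  simp only [cNormR_κ, one_mul] at hCQG
  have hD1Q : HasMaj (weightNorm (BlockNorm.ofBlocks (toB6 g R₀ H₀) 𝔬.blkZ) wZ fun y => (hwZ y).le) bout (E ∘ₗ 𝔬.G1 U ∘ₗ 𝔬.Qstar U)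
      (fun y y' => (Bq + θH * (B₃ * (1 - θ * c)⁻¹) * c) * Real.exp (-((ρ' + σ) * g.dist y y'))) :=
    hasMaj_left_rightR hG hrow hθH hBq hA₃ (by linarith) (by linarith) (by linarith) (by linarith) hKE hpQ hGQ hfix1
  have hBq' : 0 ≤ Bq + θH * (B₃ * (1 - θ * c)⁻¹) * c := add_nonneg hBq hθA₃
  have hK₂ : 0 ≤ B₃ * (B₃ * (B₀ * (1 - θ * c)⁻¹) * c) * c := mul_nonneg (mul_nonneg hB₃ hK₁) hc
  have hC : HasMaj (cNormR R₀ H₀ 𝔬.blk hG.lenle 0) bout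
      ((E ∘ₗ 𝔬.G1 U ∘ₗ 𝔬.Qstar U) ∘ₗ (𝔬.C1 U ∘ₗ (𝔬.Q U ∘ₗ (𝔬.G1 U ∘ₗ LinearMap.id))))
      (fun y y' => (weightNorm (BlockNorm.ofBlocks (toB6 g R₀ H₀) 𝔬.blkZ) wZ fun y => (hwZ y).le).κ *
        (Bq + θH * (B₃ * (1 - θ * c)⁻¹) * c) *
        (B₃ * (B₃ * (B₀ * (1 - θ * c)⁻¹) * c) * c) * c * Real.exp (-(ρ' * g.dist y y'))) :=
    hasMaj_comp_exp htri hG.dnn hrow hBq' hK₂ hρ' (by linarith) le_rfl hD1Q hCQG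
  simp only [weightNorm_ofBlocks_κ, one_mul] at hC
  -- (e) assembling (3.153) with the left factor E
  have h := ((hD1.of_rate_le hG.dnn hCL (by linarith : ρ' ≤ ρ)).sub hB).sub hC
  rw [← E_GG_eq hI E] at h
  have hC0 : 0 ≤ constH313 (Bh + θH * (B₀ * (1 - θ * c)⁻¹) * c) θH (B₀ * (1 - θ * c)⁻¹) (B₃ * (1 - θ * c)⁻¹) B₃ Bd Bq bW.κ c :=
    constH313_nonneg hCL hθH hA₁ hA₃ hB₃ hBd hBq bW.κ_nonneg hc
  have h2 : HasMaj (cNormR R₀ H₀ 𝔬.blk hG.lenle 0) bout (E ∘ₗ 𝔬.GG U)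
      (fun a b => constH313 (Bh + θH * (B₀ * (1 - θ * c)⁻¹) * c) θH (B₀ * (1 - θ * c)⁻¹) (B₃ * (1 - θ * c)⁻¹) B₃ Bd Bq bW.κ c *
        Real.exp (-(ρ' * g.dist a b))) :=
    h.mono fun a b => le_of_eq (by simp only [constH313, toB6_dist]; ring)
  have h' := hasMajorantHom_of_hasMaj_cNormR hG (fun a b => mul_nonneg hC0 (Real.exp_nonneg _)) h2
  have h'' : HasMajorantHom (g := toB6 g R₀ H₀) 𝔬.blk 𝔭.blkPY (𝔭.ΦY U β ∘ₗ (𝔬.D U ∘ₗ 𝔬.GG U))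
      (fun (a b : g.Site) => constH313 (Bh + θH * (B₀ * (1 - θ * c)⁻¹) * c) θH (B₀ * (1 - θ * c)⁻¹) (B₃ * (1 - θ * c)⁻¹) B₃ Bd Bq bW.κ c *
        Real.exp (-(ρ' * g.dist a b)) * g.len a ^ (-(β - 1)) * g.len b ^ (0 : ℝ)) := h'
  refine hasMajorantHom_mono (g := toB6 g R₀ H₀) 𝔬.blk 𝔭.blkPY h'' fun a b => le_of_eq ?_
  simp only [Real.rpow_zero, mul_one, show -(β - 1) = 1 - β by ring]
  ring

end OneMember

end

end Literature.MathematicalPhysics.QuantumFieldTheory.Balaban1983to89.B9Thm313WholeProbe43LCut
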